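import Literature.Analysis.FluidPDE.PlanarVorticityEntropy
import Literature.Analysis.FluidPDE.PlanarVorticityEntropyNonneg
import Literature.Analysis.FluidPDE.PlanarVelocityDecay
import HarnessLib

/-!
# The sup-norm relaxation of a planar viscous velocity to the Lamb–Oseen velocity field:
# `‖u(t) − K₂ ∗ g_t‖_∞ ≤ ((‖ω(t)‖_∞ + ‖g_t‖_∞) ‖ω(t) − g_t‖₁ / 2π)^{1/2}` with Gallay–Wayne's entropy clock

Literature file (topic `Analysis/FluidPDE`), theorems only: no definitions, no named facts.

Gallay–Wayne (*Global stability of vortex solutions of the two-dimensional Navier–Stokes equation*,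
Comm. Math. Phys. 255 (2005), §3.4, materialised text p. 14) prove that a positive planar vorticity of
finite relative entropy relaxes to the Oseen vortex `αG` in `L¹` at the explicit rate
`‖w(τ) − αG‖₁ ≤ √(2α) (H(w₀) − H(αG))^{1/2} e^{−τ/2}` (Csiszár–Kullback + the Stam–Gross logarithmic
Sobolev inequality); in physical variables this is the tree's
`IsClassicalNSSolutionOn.integral_abs_planarVorticity_sub_gaussian_le` (`PlanarVorticityEntropy`):
`‖ω(t) − g_t‖₁ ≤ (2Γ H(t₀) t⋆ / (t − t₀ + t⋆))^{1/2}`, `g_t(x) = Γ (4πνT)⁻¹ e^{−‖x‖²/(4νT)}`,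
`T = t − t₀ + t⋆`. Majda–Bertozzi (*Vorticity and Incompressible Flow*, §8.2.3, Prop. 8.2 (i), (8.27),
held text p. 275) bound the Biot–Savart velocity by `‖ρK‖₁ ‖ω‖_∞ + ‖(1 − ρ)K‖_∞ ‖ω‖₁`; optimised in the
cut-off radius, and applied to a DIFFERENCE of two bounded integrable vorticities (the tree's
`norm_biotSavart2D_sub_biotSavart2D_le_of_radius`, `biotSavart2D_sub`, and the sharp one-signed-majorant
form `norm_biotSavart2D_le_sqrt_of_abs_le` of `BiotSavart2DSharpSupBound`), it gives the kinematic
interpolation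

* `norm_biotSavart2D_sub_biotSavart2D_le_sqrt` — **`‖K₂ ∗ w₁(x) − K₂ ∗ w₂(x)‖ ≤ ((A₁ + A₂) ‖w₁ − w₂‖₁ / 2π)^{1/2}`**
  for integrable `wᵢ` with `|wᵢ| ≤ Aᵢ`.

Combining the two (this combination is how Gallay–Wayne's `L¹` convergence is transported to the velocity
in the vortex-dynamics literature; the constants below are the tree's, not printed ones):

* `IsClassicalNSSolutionOn.norm_sub_biotSavart2D_gaussian_le_of_le` — in the positive log-tame class of
  `PlanarVorticityEntropy` (classical planar Navier–Stokes solution on a convex time set, `ν > 0`,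
  curl-free force, `u = K₂ ∗ ω`, `ω > 0` with `|log ω| ≤ L(1 + ‖x‖)^k`, `‖∇ω‖ ≤ L(1 + ‖x‖)^k ω`), if
  `ω(t) ≤ A` then for every `x`
  **`‖u(t, x) − (K₂ ∗ g_t)(x)‖ ≤ ((A + Γ/(4πνT)) · (2Γ H(t₀) t⋆/T)^{1/2} / 2π)^{1/2}`**;
* `IsClassicalNSSolutionOn.norm_sub_biotSavart2D_gaussian_le` — the same with the tree's explicit
  any-profile ceiling `A = Γ/(ν (t − t₀))` (`planarVorticity_le_of_nonneg_explicit`, `t₀ < t`):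
  **`‖u(t, x) − (K₂ ∗ g_t)(x)‖ ≤ ((Γ/(ν(t − t₀)) + Γ/(4πνT)) · (2Γ H(t₀) t⋆/T)^{1/2} / 2π)^{1/2}`** —
  a `T^{-3/4}` law for the sup distance of the velocity to the Lamb–Oseen field.

And the kinematic half of Gallay–Wayne's similarity variables (arXiv p. 4: `ω(x,t) = t⁻¹ w(x/√t, log t)`,
`u(x,t) = t^{-1/2} v(x/√t, log t)`, `v = K₂ ∗ w`), used downstream to read the relaxation in Lundgren's
strained variables:

* `biotSavartKernel2D_smul` (`K₂(a z) = a⁻¹ K₂(z)`), `biotSavart2D_comp_smul`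
  (`K₂ ∗ (w ∘ (a·)) (x) = a⁻¹ (K₂ ∗ w)(a x)`, `a ≠ 0`), `biotSavart2D_const_mul`,
  `smul_biotSavart2D_smul_eq` (`a (K₂ ∗ w)(a x) = K₂ ∗ (a² w(a ·)) (x)`).

Here `H(t₀) = ∫ ω(t₀) log(ω(t₀)/g_{t₀})` is the relative entropy of the datum with respect to the Gaussian
of the same mass and "age" `t⋆ > 0` (a free parameter), and `K₂ ∗ g_t` is the Lamb–Oseen velocity field
written as the Biot–Savart integral of the Gaussian (the identification with the closed-form azimuthal
profile `Γ(2πr)⁻¹(1 − e^{−r²/(4νT)})` is not needed here and not restated).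

## Non-negative class (appended)

`IsClassicalNSSolutionOn.norm_sub_biotSavart2D_gaussian_le_of_le_of_nonneg` and
`…norm_sub_biotSavart2D_gaussian_le_of_nonneg` (§5) are the same two sup-norm relaxation bounds with
the positive log-tame class replaced by `ω(t₀) ≥ 0`, `∫ ω(t₀) > 0`, through
`PlanarVorticityEntropyNonneg` (Gallay–Wayne's Lemma 3.2 / §3.4 are stated for non-negative data).

## References
* [cite: GallayWayne2005, §3.4 (p. 14 of arXiv:math/0402449): `‖w(τ) − αG‖₁ ≤ √(2α) H₀^{1/2} e^{−τ/2}`]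
* [cite: MajdaBertozziCUP2002, §8.2.3 Prop. 8.2 (i) eq. (8.27) and its proof (held text p. 275)]
-/

noncomputable section

namespace Literature.Analysis.FluidPDE

open _root_.MeasureTheory _root_.Real _root_.Set

/-! ### §1 Kinematics: the sup distance of two Biot–Savart velocities -/

section Kinematic

variable {w₁ w₂ : EuclideanSpace ℝ (Fin 2) → ℝ} {A₁ A₂ : ℝ}

/-- **The velocity difference of two bounded integrable vorticities, optimised in the cut-off radius:**
`‖K₂ ∗ w₁(x) − K₂ ∗ w₂(x)‖ ≤ ((A₁ + A₂) ‖w₁ − w₂‖_{L¹} / 2π)^{1/2}` for integrable `wᵢ` with `|wᵢ| ≤ Aᵢ`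
(MB's (8.27) split applied to `w₁ − w₂`, with the sharp one-signed majorant of
`norm_biotSavart2D_le_sqrt_of_abs_le`).
[cite: MajdaBertozziCUP2002, §8.2.3 Prop. 8.2 (i) (8.27) and its proof (held text p. 275)] -/
theorem norm_biotSavart2D_sub_biotSavart2D_le_sqrt (h₁ : Integrable w₁) (hA₁ : ∀ y, |w₁ y| ≤ A₁)
    (h₂ : Integrable w₂) (hA₂ : ∀ y, |w₂ y| ≤ A₂) (x : EuclideanSpace ℝ (Fin 2)) :
    ‖biotSavart2D w₁ x - biotSavart2D w₂ x‖ ≤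
      Real.sqrt ((A₁ + A₂) * (∫ y, |w₁ y - w₂ y|) / (2 * Real.pi)) := by
  rw [biotSavart2D_sub h₁ hA₁ h₂ hA₂]
  refine norm_biotSavart2D_le_sqrt_of_abs_le (h₁.sub h₂) (fun y => ?_) x
  calc |w₁ y - w₂ y| ≤ |w₁ y| + |w₂ y| := abs_sub _ _
    _ ≤ A₁ + A₂ := add_le_add (hA₁ y) (hA₂ y)

/-- Monotonicity of the kinematic bound in the `L¹` slot: if `∫|w₁ − w₂| ≤ N` then
`‖K₂ ∗ w₁(x) − K₂ ∗ w₂(x)‖ ≤ ((A₁ + A₂) N / 2π)^{1/2}`.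
[cite: MajdaBertozziCUP2002, §8.2.3 Prop. 8.2 (i) (8.27) and its proof (held text p. 275)] -/
theorem norm_biotSavart2D_sub_biotSavart2D_le_sqrt_of_integral_le (h₁ : Integrable w₁)
    (hA₁ : ∀ y, |w₁ y| ≤ A₁) (h₂ : Integrable w₂) (hA₂ : ∀ y, |w₂ y| ≤ A₂) {N : ℝ}
    (hN : ∫ y, |w₁ y - w₂ y| ≤ N) (x : EuclideanSpace ℝ (Fin 2)) :
    ‖biotSavart2D w₁ x - biotSavart2D w₂ x‖ ≤ Real.sqrt ((A₁ + A₂) * N / (2 * Real.pi)) := by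
  refine (norm_biotSavart2D_sub_biotSavart2D_le_sqrt h₁ hA₁ h₂ hA₂ x).trans (Real.sqrt_le_sqrt ?_)
  have hA : 0 ≤ A₁ + A₂ := add_nonneg ((abs_nonneg _).trans (hA₁ x)) ((abs_nonneg _).trans (hA₂ x))
  exact div_le_div_of_nonneg_right (mul_le_mul_of_nonneg_left hN hA) (by positivity)

end Kinematic

/-! ### §2 The Oseen Gaussian as a bounded integrable vorticity -/

namespace PlanarVorticityEntropyVelocity

/-- The spreading Gaussian `g(x) = Γ (4πνT)⁻¹ e^{−‖x‖²/(4νT)}` (`Γ, ν, T > 0`) is integrable on `ℝ²` and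
`|g| ≤ Γ/(4πνT)`. [folklore] -/
private theorem gaussian_integrable_and_bounded {Γ ν T : ℝ} (hΓ : 0 < Γ) (hν : 0 < ν) (hT : 0 < T) :
    Integrable (fun x : EuclideanSpace ℝ (Fin 2) =>
        Γ / (4 * Real.pi * ν * T) * Real.exp (-(‖x‖ ^ 2 / (4 * ν * T))))
        (volume : Measure (EuclideanSpace ℝ (Fin 2))) ∧
      ∀ x : EuclideanSpace ℝ (Fin 2),
        |Γ / (4 * Real.pi * ν * T) * Real.exp (-(‖x‖ ^ 2 / (4 * ν * T)))| ≤ Γ / (4 * Real.pi * ν * T) := by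
  have hb : (0 : ℝ) < (4 * ν * T)⁻¹ := by positivity
  have h := GaussianFourier.integral_rexp_neg_mul_sq_norm (V := EuclideanSpace ℝ (Fin 2)) hb
  have e : (fun x : EuclideanSpace ℝ (Fin 2) => Real.exp (-(‖x‖ ^ 2 / (4 * ν * T)))) =
      fun x => Real.exp (-(4 * ν * T)⁻¹ * ‖x‖ ^ 2) := by
    funext x; congr 1; rw [div_eq_inv_mul, neg_mul]
  rw [finrank_euclideanSpace_fin] at h
  have hval : (Real.pi / (4 * ν * T)⁻¹) ^ ((2 : ℕ) / 2 : ℝ) = 4 * Real.pi * ν * T := by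
    rw [show ((2 : ℕ) / 2 : ℝ) = 1 by norm_num, Real.rpow_one, div_inv_eq_mul]; ring
  rw [hval] at h
  have hi : Integrable (fun x : EuclideanSpace ℝ (Fin 2) => Real.exp (-(‖x‖ ^ 2 / (4 * ν * T))))
      (volume : Measure (EuclideanSpace ℝ (Fin 2))) := by
    rw [e]
    by_contra hni
    rw [integral_undef hni] at h
    have : (0 : ℝ) < 4 * Real.pi * ν * T := by positivity
    linarith
  have hc : 0 < Γ / (4 * Real.pi * ν * T) := by positivity
  refine ⟨hi.const_mul _, fun x => ?_⟩
  rw [abs_of_nonneg (mul_nonneg hc.le (Real.exp_nonneg _))]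
  exact mul_le_of_le_one_right hc.le (Real.exp_le_one_iff.2 (neg_nonpos.2 (by positivity)))

/-- The vorticity slice of a classical planar solution is `C¹`. [folklore] -/
private theorem contDiff_one_planarVorticity_slice {S : Set ℝ} {ν : ℝ}
    {f u : ℝ → EuclideanSpace ℝ (Fin 2) → EuclideanSpace ℝ (Fin 2)} {p : ℝ → EuclideanSpace ℝ (Fin 2) → ℝ}
    (h : IsClassicalNSSolutionOn S ν f u p) {s : ℝ} (hs : s ∈ S) :
    ContDiff ℝ 1 (PlanarEigenmode.vorticity (u s)) := by
  have hu2 : ContDiff ℝ 2 (u s) := contDiff_infty.1 (h.contDiff_velocity hs) 2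
  have hD : ContDiff ℝ 1 (fderiv ℝ (u s)) := hu2.fderiv_right (m := 1) (by norm_num)
  have e : PlanarEigenmode.vorticity (u s) = fun z =>
      fderiv ℝ (u s) z (EuclideanSpace.single 0 1) 1 - fderiv ℝ (u s) z (EuclideanSpace.single 1 1) 0 := rfl
  rw [e]
  exact (contDiff_euclidean.1 (hD.clm_apply contDiff_const) 1).sub
    (contDiff_euclidean.1 (hD.clm_apply contDiff_const) 0)

end PlanarVorticityEntropyVelocity

/-! ### §3 Dynamics: the sup distance of the velocity to the Lamb–Oseen field decays like `T^{-3/4}` -/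

section Planar

open PlanarVorticityEntropyVelocity

variable {S : Set ℝ} {ν : ℝ} {f u : ℝ → EuclideanSpace ℝ (Fin 2) → EuclideanSpace ℝ (Fin 2)}
  {p : ℝ → EuclideanSpace ℝ (Fin 2) → ℝ}

/-- **The velocity relaxes to the Lamb–Oseen field in sup norm, with Gallay–Wayne's entropy clock
(given an `L^∞` bound of the vorticity).** In the positive log-tame class of `PlanarVorticityEntropy`
(classical planar Navier–Stokes solution on a convex time set `S`, `ν > 0`, curl-free force,
`u = K₂ ∗ ω` with uniformly rapidly decaying `ω > 0`, `|log ω| ≤ L(1 + ‖x‖)^k`,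
`‖∇ω‖ ≤ L(1 + ‖x‖)^k ω`), let `t₀ ≤ t` in `S`, `t⋆ > 0`, `T = t − t₀ + t⋆`, `Γ = ∫ ω(t₀)`,
`g_t(x) = Γ (4πνT)⁻¹ e^{−‖x‖²/(4νT)}` and `H(t₀) = ∫ ω(t₀) log(ω(t₀)/g_{t₀})`. If `ω(t, ·) ≤ A` then for
every `x`:
`‖u(t, x) − (K₂ ∗ g_t)(x)‖ ≤ ((A + Γ/(4πνT)) · (2 Γ H(t₀) t⋆ / T)^{1/2} / 2π)^{1/2}`
— Majda–Bertozzi (8.27) for the difference `ω(t) − g_t` (`|ω(t) − g_t| ≤ A + Γ/(4πνT)`) and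
Gallay–Wayne's `L¹` rate `‖ω(t) − g_t‖₁ ≤ (2ΓH(t₀)t⋆/T)^{1/2}`.
[cite: GallayWayne2005, §3.4 (arXiv p. 14: `‖w(τ) − αG‖₁ ≤ √(2α) H₀^{1/2} e^{−τ/2}`);
MajdaBertozziCUP2002, §8.2.3 Prop. 8.2 (i) (8.27) (held text p. 275)] -/
theorem IsClassicalNSSolutionOn.norm_sub_biotSavart2D_gaussian_le_of_le
    (h : IsClassicalNSSolutionOn S ν f u p) (hS : Convex ℝ S) (hν : 0 < ν)
    (hω : HasUniformRapidDecayOn S (fun t x => PlanarEigenmode.vorticity (u t) x))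
    (hBS : ∀ s ∈ S, ∀ x, u s x = biotSavart2D (PlanarEigenmode.vorticity (u s)) x)
    (hcurl : ∀ s ∈ S, ∀ x, PlanarEigenmode.vorticity (f s) x = 0)
    (hpos : ∀ s ∈ S, ∀ x, 0 < PlanarEigenmode.vorticity (u s) x) {L : ℝ} {k : ℕ}
    (hlog : ∀ s ∈ S, ∀ x, |Real.log (PlanarEigenmode.vorticity (u s) x)| ≤ L * (1 + ‖x‖) ^ k)
    (hsc : ∀ s ∈ S, ∀ x, ‖fderiv ℝ (PlanarEigenmode.vorticity (u s)) x‖ ≤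
      L * (1 + ‖x‖) ^ k * PlanarEigenmode.vorticity (u s) x)
    {t₀ t tstar : ℝ} (ht₀ : t₀ ∈ S) (ht : t ∈ S) (hle : t₀ ≤ t) (htstar : 0 < tstar) {A : ℝ}
    (hA : ∀ x, PlanarEigenmode.vorticity (u t) x ≤ A) (x : EuclideanSpace ℝ (Fin 2)) :
    ‖u t x - biotSavart2D (fun y =>
        (∫ y, PlanarEigenmode.vorticity (u t₀) y) / (4 * Real.pi * ν * (t - t₀ + tstar)) *
          Real.exp (-(‖y‖ ^ 2 / (4 * ν * (t - t₀ + tstar))))) x‖ ≤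
      Real.sqrt ((A + (∫ y, PlanarEigenmode.vorticity (u t₀) y) / (4 * Real.pi * ν * (t - t₀ + tstar))) *
        Real.sqrt (2 * (∫ y, PlanarEigenmode.vorticity (u t₀) y) *
          (∫ x, PlanarEigenmode.vorticity (u t₀) x * Real.log (PlanarEigenmode.vorticity (u t₀) x /
            ((∫ y, PlanarEigenmode.vorticity (u t₀) y) / (4 * Real.pi * ν * tstar) *
              Real.exp (-(‖x‖ ^ 2 / (4 * ν * tstar)))))) * tstar / (t - t₀ + tstar)) /
        (2 * Real.pi)) := by
  set Γ : ℝ := ∫ y, PlanarEigenmode.vorticity (u t₀) y with hΓdef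
  have hTt : 0 < t - t₀ + tstar := by linarith
  -- the `L¹` clock
  have hL1 := h.integral_abs_planarVorticity_sub_gaussian_le hS hν hω hBS hcurl hpos hlog hsc ht₀ ht hle
    htstar
  -- `Γ > 0`: the datum is positive and integrable
  obtain ⟨C, hC0, hC⟩ := hω.norm_le_rpow 3
  have hcont : ∀ s ∈ S, Continuous (PlanarEigenmode.vorticity (u s)) := fun s hs =>
    (contDiff_one_planarVorticity_slice h hs).continuous
  have hint : ∀ s ∈ S, Integrable (PlanarEigenmode.vorticity (u s))
      (volume : Measure (EuclideanSpace ℝ (Fin 2))) := fun s hs => by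
    refine integrable_of_norm_le_rpow_neg (hcont s hs) (C := C) (r := ((3 : ℕ) : ℝ)) ?_ fun y => hC s hs y
    rw [finrank_euclideanSpace_fin]; norm_num
  have hΓpos : 0 < Γ := by
    rw [hΓdef, integral_pos_iff_support_of_nonneg (fun y => (hpos t₀ ht₀ y).le) (hint t₀ ht₀)]
    have hsupp : Function.support (PlanarEigenmode.vorticity (u t₀)) = univ := by
      ext y; simp [Function.mem_support, (hpos t₀ ht₀ y).ne']
    rw [hsupp]
    simp
  obtain ⟨hgi, hgb⟩ := gaussian_integrable_and_bounded hΓpos hν hTt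
  -- `|ω(t)| ≤ A`
  have hωA : ∀ y, |PlanarEigenmode.vorticity (u t) y| ≤ A := fun y => by
    rw [abs_of_pos (hpos t ht y)]; exact hA y
  rw [hBS t ht x]
  exact norm_biotSavart2D_sub_biotSavart2D_le_sqrt_of_integral_le (hint t ht) hωA hgi hgb hL1 x

/-- **The velocity relaxes to the Lamb–Oseen field in sup norm like `T^{-3/4}`, for ANY positive
log-tame profile.** Same class as `norm_sub_biotSavart2D_gaussian_le_of_le`, now with `t₀ < t` and the
tree's explicit any-profile ceiling `ω(t) ≤ Γ/(ν(t − t₀))` (`planarVorticity_le_of_nonneg_explicit`):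
for every `x`,
`‖u(t, x) − (K₂ ∗ g_t)(x)‖ ≤ ((Γ/(ν(t − t₀)) + Γ/(4πνT)) · (2 Γ H(t₀) t⋆ / T)^{1/2} / 2π)^{1/2}`,
`T = t − t₀ + t⋆`.
[cite: GallayWayne2005, §3.4 (arXiv p. 14) with Thm. 1.1 eq. (1.2) (`p = ∞`);
MajdaBertozziCUP2002, §8.2.3 Prop. 8.2 (i) (8.27) (held text p. 275)] -/
theorem IsClassicalNSSolutionOn.norm_sub_biotSavart2D_gaussian_le
    (h : IsClassicalNSSolutionOn S ν f u p) (hS : Convex ℝ S) (hν : 0 < ν)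
    (hω : HasUniformRapidDecayOn S (fun t x => PlanarEigenmode.vorticity (u t) x))
    (hBS : ∀ s ∈ S, ∀ x, u s x = biotSavart2D (PlanarEigenmode.vorticity (u s)) x)
    (hcurl : ∀ s ∈ S, ∀ x, PlanarEigenmode.vorticity (f s) x = 0)
    (hpos : ∀ s ∈ S, ∀ x, 0 < PlanarEigenmode.vorticity (u s) x) {L : ℝ} {k : ℕ}
    (hlog : ∀ s ∈ S, ∀ x, |Real.log (PlanarEigenmode.vorticity (u s) x)| ≤ L * (1 + ‖x‖) ^ k)
    (hsc : ∀ s ∈ S, ∀ x, ‖fderiv ℝ (PlanarEigenmode.vorticity (u s)) x‖ ≤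
      L * (1 + ‖x‖) ^ k * PlanarEigenmode.vorticity (u s) x)
    {t₀ t tstar : ℝ} (ht₀ : t₀ ∈ S) (ht : t ∈ S) (hlt : t₀ < t) (htstar : 0 < tstar)
    (x : EuclideanSpace ℝ (Fin 2)) :
    ‖u t x - biotSavart2D (fun y =>
        (∫ y, PlanarEigenmode.vorticity (u t₀) y) / (4 * Real.pi * ν * (t - t₀ + tstar)) *
          Real.exp (-(‖y‖ ^ 2 / (4 * ν * (t - t₀ + tstar))))) x‖ ≤
      Real.sqrt (((∫ y, PlanarEigenmode.vorticity (u t₀) y) / (ν * (t - t₀)) +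
          (∫ y, PlanarEigenmode.vorticity (u t₀) y) / (4 * Real.pi * ν * (t - t₀ + tstar))) *
        Real.sqrt (2 * (∫ y, PlanarEigenmode.vorticity (u t₀) y) *
          (∫ x, PlanarEigenmode.vorticity (u t₀) x * Real.log (PlanarEigenmode.vorticity (u t₀) x /
            ((∫ y, PlanarEigenmode.vorticity (u t₀) y) / (4 * Real.pi * ν * tstar) *
              Real.exp (-(‖x‖ ^ 2 / (4 * ν * tstar)))))) * tstar / (t - t₀ + tstar)) /
        (2 * Real.pi)) := by
  have hbdd : ∀ s ∈ S, ∃ M : ℝ, ∀ y, ‖u s y‖ ≤ M := fun s hs =>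
    exists_norm_le_of_hasUniformRapidDecayOn_of_eq_biotSavart2D h.smooth_velocity hω hBS hs
  have hA : ∀ y, PlanarEigenmode.vorticity (u t) y ≤
      (∫ y, PlanarEigenmode.vorticity (u t₀) y) / (ν * (t - t₀)) := fun y =>
    (h.planarVorticity_le_of_nonneg_explicit hS hν hcurl hω hbdd ht₀ (fun z => (hpos t₀ ht₀ z).le) ht
      hlt y).2
  exact h.norm_sub_biotSavart2D_gaussian_le_of_le hS hν hω hBS hcurl hpos hlog hsc ht₀ ht hlt.le htstar
    hA x

end Planar

/-! ### §5 The same relaxation for NON-NEGATIVE vorticity (co-signedness at `t₀` only) -/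

section PlanarNonneg

open PlanarVorticityEntropyVelocity

variable {S : Set ℝ} {ν : ℝ} {f u : ℝ → EuclideanSpace ℝ (Fin 2) → EuclideanSpace ℝ (Fin 2)}
  {p : ℝ → EuclideanSpace ℝ (Fin 2) → ℝ}

/-- **The velocity relaxes to the Lamb–Oseen field in sup norm with Gallay–Wayne's entropy clock —
NON-NEGATIVE class (given an `L^∞` bound of the vorticity).** As
`norm_sub_biotSavart2D_gaussian_le_of_le`, with the positivity / log-tameness / log-Lipschitz
hypotheses replaced by `ω(t₀) ≥ 0` and `Γ = ∫ ω(t₀) > 0` (the `L¹` rate is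
`integral_abs_planarVorticity_sub_gaussian_le_of_nonneg`; `ω(t) ≥ 0` by the minimum principle):
if `ω(t, ·) ≤ A` then for every `x`,
`‖u(t, x) − (K₂ ∗ g_t)(x)‖ ≤ ((A + Γ/(4πνT)) · (2 Γ H(t₀) t⋆ / T)^{1/2} / 2π)^{1/2}`.
[cite: GallayWayne2005, §3.4 (arXiv p. 14: `‖w(τ) − αG‖₁ ≤ √(2α) H₀^{1/2} e^{−τ/2}`, non-negative
solutions); MajdaBertozziCUP2002, §8.2.3 Prop. 8.2 (i) (8.27) (held text p. 275)] -/
theorem IsClassicalNSSolutionOn.norm_sub_biotSavart2D_gaussian_le_of_le_of_nonneg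
    (h : IsClassicalNSSolutionOn S ν f u p) (hS : Convex ℝ S) (hν : 0 < ν)
    (hω : HasUniformRapidDecayOn S (fun t x => PlanarEigenmode.vorticity (u t) x))
    (hBS : ∀ s ∈ S, ∀ x, u s x = biotSavart2D (PlanarEigenmode.vorticity (u s)) x)
    (hcurl : ∀ s ∈ S, ∀ x, PlanarEigenmode.vorticity (f s) x = 0)
    {t₀ t tstar : ℝ} (ht₀ : t₀ ∈ S) (ht : t ∈ S) (hle : t₀ ≤ t) (htstar : 0 < tstar)
    (h0 : ∀ x, 0 ≤ PlanarEigenmode.vorticity (u t₀) x)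
    (hΓ : 0 < ∫ x, PlanarEigenmode.vorticity (u t₀) x) {A : ℝ}
    (hA : ∀ x, PlanarEigenmode.vorticity (u t) x ≤ A) (x : EuclideanSpace ℝ (Fin 2)) :
    ‖u t x - biotSavart2D (fun y =>
        (∫ y, PlanarEigenmode.vorticity (u t₀) y) / (4 * Real.pi * ν * (t - t₀ + tstar)) *
          Real.exp (-(‖y‖ ^ 2 / (4 * ν * (t - t₀ + tstar))))) x‖ ≤
      Real.sqrt ((A + (∫ y, PlanarEigenmode.vorticity (u t₀) y) / (4 * Real.pi * ν * (t - t₀ + tstar))) *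
        Real.sqrt (2 * (∫ y, PlanarEigenmode.vorticity (u t₀) y) *
          (∫ x, PlanarEigenmode.vorticity (u t₀) x * Real.log (PlanarEigenmode.vorticity (u t₀) x /
            ((∫ y, PlanarEigenmode.vorticity (u t₀) y) / (4 * Real.pi * ν * tstar) *
              Real.exp (-(‖x‖ ^ 2 / (4 * ν * tstar)))))) * tstar / (t - t₀ + tstar)) /
        (2 * Real.pi)) := by
  set Γ : ℝ := ∫ y, PlanarEigenmode.vorticity (u t₀) y with hΓdef
  have hTt : 0 < t - t₀ + tstar := by linarith
  -- the `L¹` clock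
  have hL1 := h.integral_abs_planarVorticity_sub_gaussian_le_of_nonneg hS hν hω hBS hcurl ht₀ ht hle
    htstar h0 hΓ
  -- integrable slices and the minimum principle
  obtain ⟨C, hC0, hC⟩ := hω.norm_le_rpow 3
  have hcont : ∀ s ∈ S, Continuous (PlanarEigenmode.vorticity (u s)) := fun s hs =>
    (contDiff_one_planarVorticity_slice h hs).continuous
  have hint : ∀ s ∈ S, Integrable (PlanarEigenmode.vorticity (u s))
      (volume : Measure (EuclideanSpace ℝ (Fin 2))) := fun s hs => by
    refine integrable_of_norm_le_rpow_neg (hcont s hs) (C := C) (r := ((3 : ℕ) : ℝ)) ?_ fun y => hC s hs y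
    rw [finrank_euclideanSpace_fin]; norm_num
  have hbdd : ∀ s ∈ S, ∃ M : ℝ, ∀ y, ‖u s y‖ ≤ M := fun s hs =>
    exists_norm_le_of_hasUniformRapidDecayOn_of_eq_biotSavart2D h.smooth_velocity hω hBS hs
  have hnnt : ∀ y, 0 ≤ PlanarEigenmode.vorticity (u t) y :=
    (h.integral_abs_planarVorticity_eq_of_nonneg hS hν.le hcurl hω hbdd ht₀ h0 ht hle).1
  obtain ⟨hgi, hgb⟩ := gaussian_integrable_and_bounded hΓ hν hTt
  -- `|ω(t)| ≤ A`
  have hωA : ∀ y, |PlanarEigenmode.vorticity (u t) y| ≤ A := fun y => by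
    rw [abs_of_nonneg (hnnt y)]; exact hA y
  rw [hBS t ht x]
  exact norm_biotSavart2D_sub_biotSavart2D_le_sqrt_of_integral_le (hint t ht) hωA hgi hgb hL1 x

/-- **The velocity relaxes to the Lamb–Oseen field in sup norm like `T^{-3/4}`, for EVERY
NON-NEGATIVE profile.** As `norm_sub_biotSavart2D_gaussian_le`, with positivity / log-tameness /
log-Lipschitz replaced by `ω(t₀) ≥ 0`, `Γ = ∫ ω(t₀) > 0`: for `t₀ < t` in `S` and every `x`,
`‖u(t, x) − (K₂ ∗ g_t)(x)‖ ≤ ((Γ/(ν(t − t₀)) + Γ/(4πνT)) · (2 Γ H(t₀) t⋆ / T)^{1/2} / 2π)^{1/2}`,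
`T = t − t₀ + t⋆` (the tree's explicit ceiling `ω(t) ≤ Γ/(ν(t − t₀))`,
`planarVorticity_le_of_nonneg_explicit`).
[cite: GallayWayne2005, §3.4 (arXiv p. 14) with Thm. 1.1 eq. (1.2) (`p = ∞`);
MajdaBertozziCUP2002, §8.2.3 Prop. 8.2 (i) (8.27) (held text p. 275)] -/
theorem IsClassicalNSSolutionOn.norm_sub_biotSavart2D_gaussian_le_of_nonneg
    (h : IsClassicalNSSolutionOn S ν f u p) (hS : Convex ℝ S) (hν : 0 < ν)
    (hω : HasUniformRapidDecayOn S (fun t x => PlanarEigenmode.vorticity (u t) x))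
    (hBS : ∀ s ∈ S, ∀ x, u s x = biotSavart2D (PlanarEigenmode.vorticity (u s)) x)
    (hcurl : ∀ s ∈ S, ∀ x, PlanarEigenmode.vorticity (f s) x = 0)
    {t₀ t tstar : ℝ} (ht₀ : t₀ ∈ S) (ht : t ∈ S) (hlt : t₀ < t) (htstar : 0 < tstar)
    (h0 : ∀ x, 0 ≤ PlanarEigenmode.vorticity (u t₀) x)
    (hΓ : 0 < ∫ x, PlanarEigenmode.vorticity (u t₀) x) (x : EuclideanSpace ℝ (Fin 2)) :
    ‖u t x - biotSavart2D (fun y =>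
        (∫ y, PlanarEigenmode.vorticity (u t₀) y) / (4 * Real.pi * ν * (t - t₀ + tstar)) *
          Real.exp (-(‖y‖ ^ 2 / (4 * ν * (t - t₀ + tstar))))) x‖ ≤
      Real.sqrt (((∫ y, PlanarEigenmode.vorticity (u t₀) y) / (ν * (t - t₀)) +
          (∫ y, PlanarEigenmode.vorticity (u t₀) y) / (4 * Real.pi * ν * (t - t₀ + tstar))) *
        Real.sqrt (2 * (∫ y, PlanarEigenmode.vorticity (u t₀) y) *
          (∫ x, PlanarEigenmode.vorticity (u t₀) x * Real.log (PlanarEigenmode.vorticity (u t₀) x /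
            ((∫ y, PlanarEigenmode.vorticity (u t₀) y) / (4 * Real.pi * ν * tstar) *
              Real.exp (-(‖x‖ ^ 2 / (4 * ν * tstar)))))) * tstar / (t - t₀ + tstar)) /
        (2 * Real.pi)) := by
  have hbdd : ∀ s ∈ S, ∃ M : ℝ, ∀ y, ‖u s y‖ ≤ M := fun s hs =>
    exists_norm_le_of_hasUniformRapidDecayOn_of_eq_biotSavart2D h.smooth_velocity hω hBS hs
  have hA : ∀ y, PlanarEigenmode.vorticity (u t) y ≤
      (∫ y, PlanarEigenmode.vorticity (u t₀) y) / (ν * (t - t₀)) := fun y =>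
    (h.planarVorticity_le_of_nonneg_explicit hS hν hcurl hω hbdd ht₀ h0 ht hlt y).2
  exact h.norm_sub_biotSavart2D_gaussian_le_of_le_of_nonneg hS hν hω hBS hcurl ht₀ ht hlt.le htstar h0
    hΓ hA x

end PlanarNonneg

/-! ### §4 Kinematics in similarity variables: dilation covariance of the Biot–Savart law -/

section Dilation

/-- The Biot–Savart kernel is homogeneous of degree `−1`: `K₂(a z) = a⁻¹ K₂(z)` (all real `a`; both
sides vanish at `a = 0` and at `z = 0` by the junk conventions `0⁻¹ = 0`).
[cite: GallayWayne2005, §1 (arXiv p. 4): the rescaled velocity `v(ξ) = (2π)⁻¹∫(ξ − η)^⊥|ξ − η|⁻² w(η)dη`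
of `ω(x,t) = t⁻¹ w(x/√t, log t)`, `u = t^{-1/2} v(x/√t, log t)`] -/
theorem biotSavartKernel2D_smul (a : ℝ) (z : EuclideanSpace ℝ (Fin 2)) :
    biotSavartKernel2D (a • z) = a⁻¹ • biotSavartKernel2D z := by
  by_cases ha : a = 0
  · subst ha; simp
  by_cases hz : z = 0
  · subst hz; simp
  have hzn : ‖z‖ ≠ 0 := norm_ne_zero_iff.2 hz
  unfold biotSavartKernel2D
  rw [perp_smul, norm_smul, smul_smul, smul_smul, mul_pow, Real.norm_eq_abs, sq_abs]
  congr 1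
  field_simp

/-- **Dilation covariance of the planar Biot–Savart law**: for `a ≠ 0` and every `x`,
`(K₂ ∗ (w ∘ (a·)))(x) = a⁻¹ (K₂ ∗ w)(a x)` — the change of variables `η = a y` (`dη = a² dy` on `ℝ²`)
and the degree-`(−1)` homogeneity of `K₂`; no integrability is needed (both sides are junk-free Bochner
integrals related by a measure-scaling). This is the kinematic half of Gallay–Wayne's similarity
variables: `ω(x,t) = t⁻¹ w(x/√t)`, `u(x,t) = t^{-1/2} v(x/√t)` with `v = K₂ ∗ w`.
[cite: GallayWayne2005, §1 (arXiv p. 4, the rescaled Biot–Savart law); Saffman1992, §13.3 eq. (26)] -/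
theorem biotSavart2D_comp_smul (w : EuclideanSpace ℝ (Fin 2) → ℝ) {a : ℝ} (ha : a ≠ 0)
    (x : EuclideanSpace ℝ (Fin 2)) :
    biotSavart2D (fun y => w (a • y)) x = a⁻¹ • biotSavart2D w (a • x) := by
  unfold biotSavart2D
  have h1 : (fun y => w (a • y) • biotSavartKernel2D (x - y)) =
      fun y => (fun η => w η • biotSavartKernel2D (x - a⁻¹ • η)) (a • y) := by
    funext y
    simp only [smul_smul, inv_mul_cancel₀ ha, one_smul]
  rw [h1, Lundgren.integral_comp_smul_two (fun η => w η • biotSavartKernel2D (x - a⁻¹ • η)) ha]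
  have h2 : ∀ η, biotSavartKernel2D (x - a⁻¹ • η) = a • biotSavartKernel2D (a • x - η) := fun η => by
    have e : x - a⁻¹ • η = a⁻¹ • (a • x - η) := by
      rw [smul_sub, smul_smul, inv_mul_cancel₀ ha, one_smul]
    rw [e, biotSavartKernel2D_smul, inv_inv]
  simp_rw [h2]
  have h3 : (fun η => w η • a • biotSavartKernel2D (a • x - η)) =
      fun η => a • (w η • biotSavartKernel2D (a • x - η)) := by
    funext η; rw [smul_comm]
  rw [h3, integral_smul, smul_smul]
  congr 1
  rw [pow_two, mul_inv, mul_assoc, inv_mul_cancel₀ ha, mul_one]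

/-- The Biot–Savart law is linear in the vorticity: `K₂ ∗ (c w) = c (K₂ ∗ w)` (no integrability needed).
[cite: MajdaBertozziCUP2002, §2.1 eq. (2.9)–(2.10) (the kernel K₂; held text p. 44)] -/
theorem biotSavart2D_const_mul (c : ℝ) (w : EuclideanSpace ℝ (Fin 2) → ℝ) (x : EuclideanSpace ℝ (Fin 2)) :
    biotSavart2D (fun y => c * w y) x = c • biotSavart2D w x := by
  unfold biotSavart2D
  rw [← integral_smul]
  congr 1
  funext y
  rw [mul_smul]

/-- **The Lundgren / similarity form of the covariance**: for `a ≠ 0`,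
`a (K₂ ∗ w)(a x) = (K₂ ∗ (y ↦ a² w(a y)))(x)` — the velocity of the amplified–compacted vorticity
`a² w(a ·)` is the compacted–amplified velocity `a v(a ·)`.
[cite: GallayWayne2005, §1 (arXiv p. 4: `ω = t⁻¹ w(x/√t)`, `u = t^{-1/2} v(x/√t)`, `v = K₂ ∗ w`);
Saffman1992, §13.3 eqs. (26), (29)] -/
theorem smul_biotSavart2D_smul_eq (w : EuclideanSpace ℝ (Fin 2) → ℝ) {a : ℝ} (ha : a ≠ 0)
    (x : EuclideanSpace ℝ (Fin 2)) :
    a • biotSavart2D w (a • x) = biotSavart2D (fun y => a ^ 2 * w (a • y)) x := by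
  have h2 : biotSavart2D (fun y => a ^ 2 * w (a • y)) x = a ^ 2 • biotSavart2D (fun y => w (a • y)) x :=
    biotSavart2D_const_mul (a ^ 2) (fun y => w (a • y)) x
  rw [h2, biotSavart2D_comp_smul w ha x, smul_smul, pow_two, mul_assoc, mul_inv_cancel₀ ha, mul_one]

end Dilation

end Literature.Analysis.FluidPDE
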